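import Literature.AlgebraicGeometry.Motives.MumfordTateGroupOfCMFamilyReflexNorm
import Literature.AlgebraicGeometry.Motives.HodgeGroupOfCMFamilyPoints
import Literature.AlgebraicGeometry.Motives.MumfordTateGroupOfCMTypeReflexNormPoints
import HarnessLib

/-!
# The joint reflex norm of the NORM-ONE units lands in the Hodge group of `⊕ᵢ V¹_{(Kᵢ,Φᵢ)}`: `L`-points for every field
# `L ↪ ℂ` (Milne's `N_∞`, `N_ℓ`) and `ℚ`-points (`N_0`) — «`N_{k,Φ}` factors through `T = 𝔾_m ×_{T^F} T^E`» for a CM ALGEBRA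

Family `hodge`, lane `lit-hodgefound` (Track 2 foundations library; Layer A3), topic `Literature/AlgebraicGeometry/Motives`,
namespace `Literature.AlgebraicGeometry.Motives.HodgeStructure`.  THEOREMS ONLY (no definition, no named fact; D-0026 net
debt `0`).  The Hodge-group companion of the seat's `Motives/MumfordTateGroupOfCMFamilyReflexNorm` (g18-#5: the joint reflex
norm `z ↦ (N_{k,Φᵢ}(L)(z))ᵢ` lands in `MT(⊕ᵢ V¹_{(Kᵢ,Φᵢ)})(L)` for every field `L ↪ ℂ` and on `ℚ`-points —
`exists_mem_mumfordTateGroupBaseChange_ofCMFamily_forall_proj_eq_mul_reflexNormPoints_of_isScalarTower`,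
`exists_mem_mumfordTateGroup_ofCMFamily_forall_apply_eq_mul_reflexNormFrom`, and its block calculus
`proj_baseChange_apply_single_baseChange_one_of_forall_proj_eq_mul`), combined with the seat's `Motives/HodgeGroupOfCMFamilyPoints`
(g18-#6: `Hg(⊕)(L) = MT(⊕)(L) ∩ ∏ᵢ U_{Kᵢ}(L)` with ONE block sufficing — `mem_hodgeGroupBaseChange_ofCMFamily_iff`,
`mem_hodgeGroupBaseChange_ofCMFamily_of_mul_conjBaseChange_eq_one`, `mem_hodgeGroup_ofCMFamily_iff`), with
`Motives/MumfordTateGroupOfCMTypeReflexNormPoints` (g18-#1: Milne's (10) as `N_L(z) · ῑN_L(z) = 1 ⟺ Nm_{L⊗k/L}(z) = 1`,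
`reflexNormPoints_mul_conjBaseChange_eq_one_iff`; the single-field models of every statement here) and with p27's
`NumberTheory/ComplexMultiplication/ReflexNormDeterminantTransitivity` ((9): `reflexNormFrom_mul_complexConj_reflexNormFrom`).

THE PRINTS.  J. S. Milne, *Complex Multiplication* (course notes) [MilneCM2006], Ch. I §1 (version 2020, pp. 16–17), VERBATIM (as
quoted in the tree's `…/ReflexNormPointsNormRelation`): «(b) Let `a ∈ k^×`; then `N_Φ̄(a) · N_Φ(a) = Nm_{k/ℚ}(a)` (9) … More
generally, for any `ℚ`-algebra `R`, `N_{k,Φ}(a) · ι_E N_{k,Φ}(a) = Nm_{k⊗_ℚR/R}(a)`, all `a ∈ (k ⊗_ℚ R)^×` (10).  REMARK 1.25 In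
terms of algebraic tori (see §4), `N_{k,Φ}` is a homomorphism `T^k → T^E` … The norm `a ↦ a · ι_E a : E^× → F^×` defines a
homomorphism `T^E → T^F`, and we let `T` equal the fibre product `T = 𝔾_m ×_{T^F} T^E` … `N_{k,Φ}` factors through `T` …
`N_0 : k^× → E^×`, `N_ℓ : k_ℓ^× → E_ℓ^×`, `N_∞ : k_∞^× → E_∞^×`»; P. Deligne, *Hodge cycles on abelian varieties*, LNM 900 (1982)
[Deligne1982HodgeCycles], I Example 3.7 (d) (re-edition p. 26): «since `Σ + ιΣ = 1` on `S` … (d) says that `G(ℚ) ⊆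
{(x,y) ∈ E^× × ℚ^× | Nm_{E/F}(x) ∈ ℚ^×}`», for the CM ALGEBRA `E = ∏ᵢ Kᵢ`; B. Moonen, *An introduction to Mumford–Tate
groups* (2004) [Moonen2004MT] (5.8) «`Hg(X) := Ker(MT(X) ↪ CSp(V, φ) —ν→ 𝔾_m)`».  Read together: the JOINT reflex norm
`(N_{k,Φᵢ})ᵢ` has all its block norms `N ῑN` equal to `Nm(z)` (10), the multiplier; so the norm-one units land in `Ker ν = Hg`.

WHAT IS PROVED (`Kᵢ` CM fields, `I ≠ ∅`, `k ⊂ ℂ` a number field with `E*(Kᵢ,Φᵢ) ≤ k` for all `i`).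
* §1 (ANY field `L ⊇ ℚ`) **`mem_hodgeGroupBaseChange_ofCMFamily_iff_norm_eq_one_of_forall_proj_eq_mul_reflexNormPoints`** — a
  point `γ ∈ MT(⊕)(L)` with blocks `N_{k,Φᵢ}(L)(z)` lies in `Hg(⊕)(L)` IFF `Nm_{L⊗k/L}(z) = 1`; (`L ↪ ℂ`)
  **`exists_mem_hodgeGroupBaseChange_ofCMFamily_forall_proj_eq_mul_reflexNormPoints_of_isScalarTower`** — the joint reflex norm
  of a norm-one unit IS a point of `Hg(⊕)(L)`; `…_blockUnits_eq_reflexNormPoints_of_isScalarTower`.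
* §2 `…_of_ringHom` (any embedding `L →+* ℂ`), `…_real_…` (`N_∞`), `…_padic_…` (`N_ℓ`).
* §3 (`ℚ`-points, Tannaka-free groups; `N_0`) **`mem_hodgeGroup_ofCMFamily_iff_norm_eq_one_of_forall_apply_eq_mul_reflexNormFrom`**
  (`(v ↦ (vᵢ N_{k,Φᵢ}(a))ᵢ) ∈ Hg(⊕)(ℚ) ⟺ Nm_{k/ℚ}(a) = 1`), **`exists_mem_hodgeGroup_ofCMFamily_forall_apply_eq_mul_reflexNormFrom`**.

NOT HERE: the `ℂ`-points EQUALITY `Hg(⊕)(ℂ)` = joint reflex norms of the norm-one units (sibling file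
`Motives/MumfordTateGroupOfCMFamilyReflexNormImage` §3, which needs the generation statement); the statements as morphisms
of algebraic tori over `ℚ`; empty families (`Hg = MT = 1`).

## References
* [MilneCM2006] J. S. Milne, *Complex Multiplication* (course notes; version 2020) — Ch. I §1 Rem. 1.24 (b) (9), (10), Rem. 1.25.
* [Moonen2004MT] B. Moonen, *An introduction to Mumford–Tate groups* (2004) — (5.8).
* [Deligne1982HodgeCycles] P. Deligne, *Hodge cycles on abelian varieties*, in LNM 900 (1982) — I Example 3.7 (d).
* [GreenGriffithsKerr2012] M. Green, P. A. Griffiths, M. Kerr, *Mumford–Tate Groups and Domains*, Ann. of Math. Stud. 183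
  (2012) — §V.D Prop. (V.D.4).

## Provenance
Lane `lit-hodgefound` (Hodge path, Track 2), prover seat `lit-hodgefound-p29` (generation 19), self-proposed row g19-#3 = free
pointer (α) of the seat's generation-18 closing line («Hodge-group companion of the joint reflex norm for families — combine
g18-#5 + g18-#6 …; single-type model `mem_hodgeGroupBaseChange_iff_norm_eq_one_of_apply_one_eq_reflexNormPoints`»).
-/

noncomputable section

open scoped TensorProduct Classical
open Module NumberField

namespace Literature.AlgebraicGeometry.Motives

namespace HodgeStructure

open RealMult (embCoords embCoords_tmul)
open Literature.NumberTheory.ComplexMultiplication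

variable {I : Type} [Fintype I] [DecidableEq I] {K : I → Type} [∀ i, Field (K i)] [∀ i, NumberField (K i)]
  [∀ i, IsCMField (K i)] (Φ : ∀ i, CMType (K i)) [HodgeTensorFacts.{0, 0}] (k : IntermediateField ℚ ℂ) [NumberField k]

omit [Fintype I] [DecidableEq I] [∀ i, NumberField (K i)] [∀ i, IsCMField (K i)] [HodgeTensorFacts.{0, 0}] [NumberField k] in
/-- A non-trivial product `∏ᵢ Kᵢ` has a non-empty index set. Private plumbing. [folklore] -/
private theorem nonempty_of_nontrivial_pi'' [Nontrivial (∀ i, K i)] : Nonempty I := by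
  by_contra h
  haveI : IsEmpty I := not_nonempty_iff.1 h
  exact zero_ne_one (Subsingleton.elim (0 : ∀ i, K i) 1)

/-! ### §1 `L`-points for every field `L ⊇ ℚ`: `Hg(⊕)(L) ∩ {blocks N_{k,Φᵢ}(L)(z)} ⟺ Nm_{L⊗k/L}(z) = 1` -/

section Points

variable (L : Type) [Field L] [Algebra ℚ L]

/-- **`γ ∈ Hg(⊕ᵢ V¹_{(Kᵢ,Φᵢ)})(L) ⟺ Nm_{L⊗k/L}(z) = 1` for a point `γ ∈ MT(⊕ᵢ V¹_{(Kᵢ,Φᵢ)})(L)` whose blocks are the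
multiplications by the reflex norms `N_{k,Φᵢ}(L)(z)`** (CM fields `Kᵢ`, `I ≠ ∅`, `k ⊇ E*(Kᵢ,Φᵢ)` for all `i`, ANY field
`L ⊇ ℚ`): `Hg(L) = MT(L) ∩ {uᵢ ῑuᵢ = 1}` with one block sufficing (the tree's `mem_hodgeGroupBaseChange_ofCMFamily_iff`,
`…_of_mul_conjBaseChange_eq_one`; Moonen (5.8) «`Hg(X) := Ker(MT(X) ↪ CSp(V, φ) —ν→ 𝔾_m)`») and Milne's (10)
`N_L(z) · ῑN_L(z) = Nm(z) ⊗ 1` (`reflexNormPoints_mul_conjBaseChange_eq_one_iff`).  Milne Rem. 1.25: «The norm `a ↦ a · ι_E a :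
E^× → F^×` defines a homomorphism `T^E → T^F`, and we let `T` equal the fibre product `T = 𝔾_m ×_{T^F} T^E` … `N_{k,Φ}`
factors through `T`», here jointly for the CM algebra `E = ∏ᵢ Kᵢ`; Deligne (d) «`G(ℚ) ⊆ {(x,y) ∈ E^× × ℚ^× | Nm_{E/F}(x) ∈
ℚ^×}`».  Single-field case: the tree's `mem_hodgeGroupBaseChange_iff_norm_eq_one_of_apply_one_eq_reflexNormPoints`.
[cite: MilneCM2006, Ch. I §1 Rem. 1.24 (b) (10) and Rem. 1.25] [cite: Moonen2004MT, (5.8)]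
[cite: Deligne1982HodgeCycles, I Example 3.7 (d) (p. 26)] -/
theorem mem_hodgeGroupBaseChange_ofCMFamily_iff_norm_eq_one_of_forall_proj_eq_mul_reflexNormPoints
    [Nontrivial (∀ i, K i)] (hk : ∀ i, traceField (Φ i) ≤ k)
    {γ : (L ⊗[ℚ] (∀ i, K i)) ≃ₗ[L] (L ⊗[ℚ] (∀ i, K i))} (hγ : γ ∈ (ofCMFamily Φ).mumfordTateGroupBaseChange L)
    {z : L ⊗[ℚ] k}
    (hγz : ∀ i x, (LinearMap.proj i : (∀ k, K k) →ₗ[ℚ] K i).baseChange L (γ x) =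
      (LinearMap.proj i : (∀ k, K k) →ₗ[ℚ] K i).baseChange L x * reflexNormPoints (K i) (Φ i) k L z) :
    γ ∈ (ofCMFamily Φ).hodgeGroupBaseChange L ↔ Algebra.norm L z = 1 := by
  obtain ⟨i₀⟩ := nonempty_of_nontrivial_pi'' (K := K)
  constructor
  · intro hγHg
    have h1 := ((mem_hodgeGroupBaseChange_ofCMFamily_iff Φ L).1 hγHg).2 i₀
    rw [proj_baseChange_apply_single_baseChange_one_of_forall_proj_eq_mul L hγz i₀] at h1
    exact (reflexNormPoints_mul_conjBaseChange_eq_one_iff (Φ i₀) k L (hk i₀) z).1 h1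
  · intro hz
    refine mem_hodgeGroupBaseChange_ofCMFamily_of_mul_conjBaseChange_eq_one Φ L hγ i₀ ?_
    rw [proj_baseChange_apply_single_baseChange_one_of_forall_proj_eq_mul L hγz i₀]
    exact (reflexNormPoints_mul_conjBaseChange_eq_one_iff (Φ i₀) k L (hk i₀) z).2 hz

variable [Algebra L ℂ] [IsScalarTower ℚ L ℂ]

/-- **THE JOINT REFLEX NORM OF A NORM-ONE UNIT LANDS IN THE HODGE GROUP, on `L`-points for every field `L ⊆ ℂ`**: for
`k ⊇ E*(Kᵢ,Φᵢ)` (all `i`) and `z ∈ (L ⊗ k)^×` with `Nm_{L⊗k/L}(z) = 1` there is `γ ∈ Hg(⊕ᵢ V¹_{(Kᵢ,Φᵢ)})(L)` acting on each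
block `L ⊗ Kᵢ` as multiplication by `N_{k,Φᵢ}(L)(z)` — the `L`-points of «`N_{k,Φ}` factors through `T = 𝔾_m ×_{T^F} T^E`»,
jointly for the family (the `MT` statement is the tree's
`exists_mem_mumfordTateGroupBaseChange_ofCMFamily_forall_proj_eq_mul_reflexNormPoints_of_isScalarTower`; single-field case:
`exists_mem_hodgeGroupBaseChange_apply_one_eq_reflexNormPoints_of_isScalarTower`).
[cite: MilneCM2006, Ch. I §1 Rem. 1.24 (b) (10) and Rem. 1.25] [cite: Moonen2004MT, (5.8)]
[cite: Deligne1982HodgeCycles, I Example 3.7 (d) (p. 26)] -/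
theorem exists_mem_hodgeGroupBaseChange_ofCMFamily_forall_proj_eq_mul_reflexNormPoints_of_isScalarTower
    [Nontrivial (∀ i, K i)] (hk : ∀ i, traceField (Φ i) ≤ k) (z : (L ⊗[ℚ] k)ˣ)
    (hz : Algebra.norm L (z : L ⊗[ℚ] k) = 1) :
    ∃ γ ∈ (ofCMFamily Φ).hodgeGroupBaseChange L,
      ∀ i x, (LinearMap.proj i : (∀ k, K k) →ₗ[ℚ] K i).baseChange L (γ x) =
        (LinearMap.proj i : (∀ k, K k) →ₗ[ℚ] K i).baseChange L x * reflexNormPoints (K i) (Φ i) k L z := by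
  obtain ⟨γ, hγMT, hγ⟩ :=
    exists_mem_mumfordTateGroupBaseChange_ofCMFamily_forall_proj_eq_mul_reflexNormPoints_of_isScalarTower L Φ k hk z
  exact ⟨γ, (mem_hodgeGroupBaseChange_ofCMFamily_iff_norm_eq_one_of_forall_proj_eq_mul_reflexNormPoints Φ k L hk hγMT
    hγ).2 hz, hγ⟩

/-- The same through the block units: `uᵢ(γ) = (πᵢ)_L γ (ιᵢ)_L (1) = N_{k,Φᵢ}(L)(z)` for all `i`, for some
`γ ∈ Hg(⊕ᵢ V¹_{(Kᵢ,Φᵢ)})(L)`, when `Nm_{L⊗k/L}(z) = 1`. [cite: MilneCM2006, Ch. I §1 Rem. 1.25] [cite: Moonen2004MT, (5.8)] -/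
theorem exists_mem_hodgeGroupBaseChange_ofCMFamily_blockUnits_eq_reflexNormPoints_of_isScalarTower
    [Nontrivial (∀ i, K i)] (hk : ∀ i, traceField (Φ i) ≤ k) (z : (L ⊗[ℚ] k)ˣ)
    (hz : Algebra.norm L (z : L ⊗[ℚ] k) = 1) :
    ∃ γ ∈ (ofCMFamily Φ).hodgeGroupBaseChange L,
      ∀ i, (LinearMap.proj i : (∀ k, K k) →ₗ[ℚ] K i).baseChange L (γ ((LinearMap.single ℚ K i).baseChange L 1)) =
        reflexNormPoints (K i) (Φ i) k L z := by
  obtain ⟨γ, hγ, hγz⟩ :=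
    exists_mem_hodgeGroupBaseChange_ofCMFamily_forall_proj_eq_mul_reflexNormPoints_of_isScalarTower Φ k L hk z hz
  exact ⟨γ, hγ, fun i => proj_baseChange_apply_single_baseChange_one_of_forall_proj_eq_mul L hγz i⟩

end Points

/-! ### §2 Any embedding `L → ℂ`; real and `ℓ`-adic points (Milne's `N_∞`, `N_ℓ` restricted to norm-one units) -/

section AnyEmbedding

variable (L : Type) [Field L] [Algebra ℚ L]

/-- §1 for an arbitrary embedding `φ : L →+* ℂ` (the statement is embedding-free). [cite: MilneCM2006, Ch. I §1 Rem. 1.25]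
[cite: Moonen2004MT, (5.8)] -/
theorem exists_mem_hodgeGroupBaseChange_ofCMFamily_forall_proj_eq_mul_reflexNormPoints_of_ringHom
    [Nontrivial (∀ i, K i)] (φ : L →+* ℂ) (hk : ∀ i, traceField (Φ i) ≤ k) (z : (L ⊗[ℚ] k)ˣ)
    (hz : Algebra.norm L (z : L ⊗[ℚ] k) = 1) :
    ∃ γ ∈ (ofCMFamily Φ).hodgeGroupBaseChange L,
      ∀ i x, (LinearMap.proj i : (∀ k, K k) →ₗ[ℚ] K i).baseChange L (γ x) =
        (LinearMap.proj i : (∀ k, K k) →ₗ[ℚ] K i).baseChange L x * reflexNormPoints (K i) (Φ i) k L z := by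
  letI : Algebra L ℂ := φ.toAlgebra
  haveI : IsScalarTower ℚ L ℂ := IsScalarTower.of_algebraMap_eq fun q => by
    rw [RingHom.algebraMap_toAlgebra, eq_ratCast, eq_ratCast, map_ratCast]
  exact exists_mem_hodgeGroupBaseChange_ofCMFamily_forall_proj_eq_mul_reflexNormPoints_of_isScalarTower Φ k L hk z hz

/-- **`N_∞` on norm-one units lands in `Hg(⊕ᵢ V¹_{(Kᵢ,Φᵢ)})(ℝ)`** (the real points of the Hodge group, the group whose
real form is compact modulo … — here only the algebraic statement). [cite: MilneCM2006, Ch. I §1 Rem. 1.25 («N_∞»)]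
[cite: Moonen2004MT, (5.8)] -/
theorem exists_mem_hodgeGroupBaseChange_ofCMFamily_real_forall_proj_eq_mul_reflexNormPoints
    [Nontrivial (∀ i, K i)] (hk : ∀ i, traceField (Φ i) ≤ k) (z : (ℝ ⊗[ℚ] k)ˣ) (hz : Algebra.norm ℝ (z : ℝ ⊗[ℚ] k) = 1) :
    ∃ γ ∈ (ofCMFamily Φ).hodgeGroupBaseChange ℝ,
      ∀ i x, (LinearMap.proj i : (∀ k, K k) →ₗ[ℚ] K i).baseChange ℝ (γ x) =
        (LinearMap.proj i : (∀ k, K k) →ₗ[ℚ] K i).baseChange ℝ x * reflexNormPoints (K i) (Φ i) k ℝ z :=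
  exists_mem_hodgeGroupBaseChange_ofCMFamily_forall_proj_eq_mul_reflexNormPoints_of_isScalarTower Φ k ℝ hk z hz

variable (ℓ : ℕ) [Fact ℓ.Prime]

omit [Fintype I] [DecidableEq I] [∀ i, NumberField (K i)] [∀ i, IsCMField (K i)] [HodgeTensorFacts.{0, 0}] [NumberField k] in
/-- A ring embedding `ℚ_ℓ → ℂ` (`ℚ_ℓ ⊂ ℚ̄_ℓ ≃ ℂ`). Private plumbing. [folklore] -/
private theorem nonempty_padic_ringHom_complex'' : Nonempty (ℚ_[ℓ] →+* ℂ) :=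
  let ⟨e⟩ := PadicAlgCl.nonempty_ringEquiv_complex ℓ
  ⟨e.toRingHom.comp (algebraMap ℚ_[ℓ] (PadicAlgCl ℓ))⟩

/-- **`N_ℓ` on norm-one units lands in `Hg(⊕ᵢ V¹_{(Kᵢ,Φᵢ)})(ℚ_ℓ)`.** [cite: MilneCM2006, Ch. I §1 Rem. 1.25 («N_ℓ»)]
[cite: Moonen2004MT, (5.8)] -/
theorem exists_mem_hodgeGroupBaseChange_ofCMFamily_padic_forall_proj_eq_mul_reflexNormPoints
    [Nontrivial (∀ i, K i)] (hk : ∀ i, traceField (Φ i) ≤ k) (z : (ℚ_[ℓ] ⊗[ℚ] k)ˣ)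
    (hz : Algebra.norm ℚ_[ℓ] (z : ℚ_[ℓ] ⊗[ℚ] k) = 1) :
    ∃ γ ∈ (ofCMFamily Φ).hodgeGroupBaseChange ℚ_[ℓ],
      ∀ i x, (LinearMap.proj i : (∀ k, K k) →ₗ[ℚ] K i).baseChange ℚ_[ℓ] (γ x) =
        (LinearMap.proj i : (∀ k, K k) →ₗ[ℚ] K i).baseChange ℚ_[ℓ] x * reflexNormPoints (K i) (Φ i) k ℚ_[ℓ] z := by
  obtain ⟨φ⟩ := nonempty_padic_ringHom_complex'' ℓ
  exact exists_mem_hodgeGroupBaseChange_ofCMFamily_forall_proj_eq_mul_reflexNormPoints_of_ringHom Φ k ℚ_[ℓ] φ hk z hz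

end AnyEmbedding

/-! ### §3 `ℚ`-points (Milne's `N_0`): `v ↦ (vᵢ · N_{k,Φᵢ}(a))ᵢ ∈ Hg(⊕)(ℚ) ⟺ Nm_{k/ℚ}(a) = 1` -/

section RationalPoints

/-- **`(v ↦ (vᵢ · N_{k,Φᵢ}(a))ᵢ) ∈ Hg(⊕ᵢ V¹_{(Kᵢ,Φᵢ)})(ℚ) ⟺ Nm_{k/ℚ}(a) = 1`** for the Tannaka-free groups of `ℚ`-points: a
rational point `g ∈ MT(⊕ᵢ V¹_{(Kᵢ,Φᵢ)})(ℚ)` acting as the joint reflex norm on ELEMENTS (`reflexNormFrom (K i) (Φ i) k a`,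
Milne's `N_0`; such `g` exist by the tree's `exists_mem_mumfordTateGroup_ofCMFamily_forall_apply_eq_mul_reflexNormFrom`) lies in
the Hodge group iff `a` has norm `1`: `Hg(ℚ) = MT(ℚ) ∩ {xᵢ x̄ᵢ = 1}` (the tree's `mem_hodgeGroup_ofCMFamily_iff`) and (9)
`N_{k,Φᵢ}(a) · ι N_{k,Φᵢ}(a) = Nm_{k/ℚ}(a)` (`reflexNormFrom_mul_complexConj_reflexNormFrom`).  Single-field case:
`mem_hodgeGroup_iff_norm_eq_one_of_forall_apply_eq_mul_reflexNormFrom`. [cite: MilneCM2006, Ch. I §1 Rem. 1.24 (b) (9) and Rem. 1.25 («N_0»)]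
[cite: Moonen2004MT, (5.8)] [cite: Deligne1982HodgeCycles, I Example 3.7 (d) (p. 26)] -/
theorem mem_hodgeGroup_ofCMFamily_iff_norm_eq_one_of_forall_apply_eq_mul_reflexNormFrom [Nontrivial (∀ i, K i)]
    (hk : ∀ i, traceField (Φ i) ≤ k) {g : (∀ i, K i) ≃ₗ[ℚ] (∀ i, K i)} (hgMT : g ∈ (ofCMFamily Φ).mumfordTateGroup)
    {a : k} (hg : ∀ (v : ∀ i, K i) i, g v i = v i * reflexNormFrom (K i) (Φ i) k a) :
    g ∈ (ofCMFamily Φ).hodgeGroup ↔ Algebra.norm ℚ a = 1 := by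
  obtain ⟨i₀⟩ := nonempty_of_nontrivial_pi'' (K := K)
  have hblock : ∀ i, g (Pi.single i 1) i * IsCMField.complexConj (K i) (g (Pi.single i 1) i) =
      algebraMap ℚ (K i) (Algebra.norm ℚ a) := fun i => by
    rw [hg, Pi.single_eq_same, one_mul, reflexNormFrom_mul_complexConj_reflexNormFrom (K i) (Φ i) k (hk i) a]
  rw [mem_hodgeGroup_ofCMFamily_iff Φ]
  constructor
  · rintro ⟨-, h⟩
    have h1 := h i₀
    rw [hblock i₀, map_eq_one_iff _ (algebraMap ℚ (K i₀)).injective] at h1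
    exact h1
  · intro ha
    exact ⟨hgMT, fun i => by rw [hblock i, ha, map_one]⟩

/-- **Norm-one elements of `k` give `ℚ`-points of the Hodge group of the family**: for `a ∈ k` with `Nm_{k/ℚ}(a) = 1` the
rational automorphism `v ↦ (vᵢ · N_{k,Φᵢ}(a))ᵢ` of `V = ∏ᵢ Kᵢ` lies in `Hg(⊕ᵢ V¹_{(Kᵢ,Φᵢ)})(ℚ)` — the Hodge-group companion of
the tree's «`η(N_{Π′}(F′,*)) ⊂ M_φ̃(ℚ)`» for families. [cite: MilneCM2006, Ch. I §1 Rem. 1.24 (b) (9) and Rem. 1.25]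
[cite: GreenGriffithsKerr2012, §V.D Prop. (V.D.4)] [cite: Moonen2004MT, (5.8)] -/
theorem exists_mem_hodgeGroup_ofCMFamily_forall_apply_eq_mul_reflexNormFrom [Nontrivial (∀ i, K i)]
    (hk : ∀ i, traceField (Φ i) ≤ k) {a : k} (ha : Algebra.norm ℚ a = 1) :
    ∃ g ∈ (ofCMFamily Φ).hodgeGroup, ∀ (v : ∀ i, K i) i, g v i = v i * reflexNormFrom (K i) (Φ i) k a := by
  have ha0 : a ≠ 0 := fun h => by
    rw [h, Algebra.norm_zero] at ha
    exact zero_ne_one ha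
  obtain ⟨g, hg, hgv⟩ := exists_mem_mumfordTateGroup_ofCMFamily_forall_apply_eq_mul_reflexNormFrom Φ k hk ha0
  exact ⟨g, (mem_hodgeGroup_ofCMFamily_iff_norm_eq_one_of_forall_apply_eq_mul_reflexNormFrom Φ k hk hg hgv).2 ha, hgv⟩

end RationalPoints

end HodgeStructure

end Literature.AlgebraicGeometry.Motives

end
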